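import Mathlib.FieldTheory.Galois.Infinite
import Mathlib.FieldTheory.KrullTopology
import Mathlib.GroupTheory.FiniteAbelian.Duality
import Mathlib.RingTheory.RootsOfUnity.EnoughRootsOfUnity
import Mathlib.Topology.Algebra.OpenSubgroup
import HarnessLib

/-!
# Kummer theory, containment form: every open-kernel exponent-`N` abelian character of `Gal(K/F)` kills `Gal(K/F(F^{1/N}))`

Topic `Literature/FieldTheory`.  Let `K/k` be a Galois extension (`IsGalois k K`; e.g. `K` an algebraic closure of a field
of characteristic `0`), `F` an intermediate field containing EVERY `N`-th root of unity of `K`, `K` with enough `N`-th roots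
of unity and of characteristic `0`.  Write `F(F^{1/N}) := k(F ∪ {x ∈ K | x^N ∈ F})` — "`F` with all `N`-th roots of all its
elements adjoined" (for the abc-iut cell: `J_N = K_N(a^{1/N})_{a ∈ K_N}` of [EtTh] §1 p. 14, typed as
`Literature.AnabelianGeometry.EtaleTheta.fieldJN`).

**Theorem** (`fixingSubgroup_adjoin_roots_le_ker`).  For every homomorphism `φ : Gal(K/F) → A` to a finite commutative
group with `a^N = 1` for all `a`, whose kernel is OPEN in `Gal(K/k)` (Krull topology), one has
`Gal(K/F(F^{1/N})) ≤ Ker φ`: `σ ∈ Gal(K/F(F^{1/N}))` implies `σ ∈ Gal(K/F)` and `φ σ = 1`.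

This is the containment half of Kummer theory for ABELIAN extensions of exponent `N` (Mathlib has the cyclic case,
`FieldTheory/KummerExtension`): the fixed field `L` of `Ker φ` is generated over `F` by `N`-th roots of elements of `F`.
PROOF (eigen-decomposition, no structure theorem for `A`): reduce to `φ` surjective and choose a set-theoretic section
`s : A → Gal(K/F)`.  For `x ∈ L` and a character `χ : A → Kˣ` put `x_χ := Σ_{a ∈ A} χ(a)⁻¹ · s(a)(x)`.  Since the values of `χ`
are `N`-th roots of unity (so lie in `F`) and `τ s(a) ≡ s(φ(τ) a)` modulo `Ker φ` (which fixes `x`), every `τ ∈ Gal(K/F)`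
acts by `τ(x_χ) = χ(φ τ) · x_χ`; hence `x_χ^N` is `Gal(K/F)`-fixed, i.e. `x_χ^N ∈ F` (Galois correspondence
`InfiniteGalois.fixedField_fixingSubgroup`), so `x_χ ∈ F(F^{1/N})`.  Character orthogonality (characters `A → Kˣ` SEPARATE
points: Mathlib `CommGroup.exists_apply_ne_one_of_hasEnoughRootsOfUnity`) gives `Σ_χ x_χ = #(A → Kˣ) · x`, so `x ∈ F(F^{1/N})`.
Thus `L ≤ F(F^{1/N})` and `Gal(K/F(F^{1/N})) ≤ Gal(K/L) = Ker φ` (the kernel is open, hence closed: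
`InfiniteGalois.fixingSubgroup_fixedField`).

Mathlib-only; theorems only (no definitions, no named facts, no `sorry`).  Classical (Kummer 1840s; e.g. Lang, *Algebra*,
VI §8 Thm. 8.2; Neukirch, *ANT* IV (3.6)); recorded for the abc-iut cell (seat abc-iut-w5-d062; consumer: the origin clause
`GtpZNFromSplitting` of [EtTh] §1 at the χ-model).  `-- TODO(general form):` characteristic `0` can be weakened to
`char K ∤ N`.  Nothing here bears on [IUTchIII] Cor. 3.12.

## References
* S. Lang, *Algebra*, rev. 3rd ed., Springer GTM 211 (2002), Ch. VI §8, Thm. 8.2. [Lang2002]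
* J. Neukirch, *Algebraic Number Theory*, Springer (1999), Ch. IV (3.6). [NeukirchANT1999]
-/

noncomputable section

open scoped Pointwise

namespace Literature.FieldTheory

namespace KummerContainment

universe u v

variable {k : Type u} {K : Type v} [Field k] [Field K] [Algebra k K]

/-! ### Character orthogonality over a field -/

/-- **Characters of a finite commutative group with values in a field with enough roots of unity sum to zero off the
identity**: `Σ_χ χ(a) = 0` for `a ≠ 1` (the characters separate points, Mathlib
`CommGroup.exists_apply_ne_one_of_hasEnoughRootsOfUnity`). [cite: Lang2002, Ch. VI §8] -/
theorem sum_character_apply_eq_zero {A : Type*} [CommGroup A] [Fintype A]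
    [HasEnoughRootsOfUnity K (Monoid.exponent A)] [Fintype (A →* Kˣ)] {a : A} (ha : a ≠ 1) :
    ∑ χ : A →* Kˣ, ((χ a : Kˣ) : K) = 0 := by
  obtain ⟨ψ, hψ⟩ := CommGroup.exists_apply_ne_one_of_hasEnoughRootsOfUnity A K ha
  set S : K := ∑ χ : A →* Kˣ, ((χ a : Kˣ) : K) with hS
  have hmul : ((ψ a : Kˣ) : K) * S = S := by
    rw [hS, Finset.mul_sum]
    refine Fintype.sum_equiv (Equiv.mulLeft ψ) _ _ fun χ => ?_
    simp only [Equiv.coe_mulLeft, MonoidHom.mul_apply, Units.val_mul]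
  have hψ1 : ((ψ a : Kˣ) : K) ≠ 1 := fun h => hψ (Units.val_eq_one.mp h)
  have h0 : (((ψ a : Kˣ) : K) - 1) * S = 0 := by rw [sub_mul, one_mul, hmul, sub_self]
  rcases mul_eq_zero.mp h0 with h | h
  · exact absurd (sub_eq_zero.mp h) hψ1
  · exact h

/-- `Σ_χ χ(1) = #(A → Kˣ)`. [cite: Lang2002, Ch. VI §8] -/
theorem sum_character_apply_one {A : Type*} [CommGroup A] [Fintype (A →* Kˣ)] :
    ∑ χ : A →* Kˣ, ((χ (1 : A) : Kˣ) : K) = Fintype.card (A →* Kˣ) := by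
  simp only [map_one, Units.val_one, Finset.sum_const, Finset.card_univ, nsmul_eq_mul, mul_one]

/-! ### The containment theorem -/

section Main

variable [IsGalois k K] (F : IntermediateField k K) (N : ℕ) [NeZero N]

-- `F(F^{1/N})` is written out as `IntermediateField.adjoin k ((F : Set K) ∪ {x : K | x ^ N ∈ F})` throughout
-- (the shape of the abc-iut cell's `fieldJN`); no notation, no definition.

omit [IsGalois k K] [NeZero N] in
/-- `F ≤ F(F^{1/N})`. [cite: Lang2002, Ch. VI §8] -/
theorem le_adjoin_roots : F ≤ IntermediateField.adjoin k ((F : Set K) ∪ {x : K | x ^ N ∈ F}) := fun _ hx =>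
  IntermediateField.subset_adjoin k _ (Set.mem_union_left _ hx)

omit [IsGalois k K] [NeZero N] in
/-- An `N`-th root of an element of `F` lies in `F(F^{1/N})`. [cite: Lang2002, Ch. VI §8] -/
theorem mem_adjoin_roots_of_pow_mem {x : K} (hx : x ^ N ∈ F) : x ∈ IntermediateField.adjoin k ((F : Set K) ∪ {x : K | x ^ N ∈ F}) :=
  IntermediateField.subset_adjoin k _ (Set.mem_union_right _ hx)

/-- **Core case (surjective `φ`).**  For `φ : Gal(K/F) ↠ A` onto a finite commutative group killed by `N`, with kernel open in
`Gal(K/k)`, `F ⊇ μ_N(K)`, `K` of characteristic `0` with enough `N`-th roots of unity: every element of the fixed field of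
`Ker φ` lies in `F(F^{1/N})`. [cite: Lang2002, Ch. VI §8 Thm. 8.2] -/
theorem fixedField_ker_le_adjoin_roots_of_surjective [CharZero K] [HasEnoughRootsOfUnity K N]
    (hμ : ∀ ζ : K, ζ ^ N = 1 → ζ ∈ F)
    {A : Type*} [CommGroup A] [Finite A] (hA : ∀ a : A, a ^ N = 1)
    (φ : ↥F.fixingSubgroup →* A) (hφ : Function.Surjective φ) :
    IntermediateField.fixedField (φ.ker.map F.fixingSubgroup.subtype) ≤ IntermediateField.adjoin k ((F : Set K) ∪ {x : K | x ^ N ∈ F}) := by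
  classical
  intro x hx
  haveI : Fintype A := Fintype.ofFinite A
  -- enough roots of unity for the exponent of `A`
  have hexp : Monoid.exponent A ∣ N := Monoid.exponent_dvd_iff_forall_pow_eq_one.mpr hA
  haveI : HasEnoughRootsOfUnity K (Monoid.exponent A) := HasEnoughRootsOfUnity.of_dvd K hexp
  -- the character group is finite (duality)
  haveI : Finite (A →* Kˣ) :=
    Finite.of_equiv A (CommGroup.monoidHom_mulEquiv_of_hasEnoughRootsOfUnity A K).some.toEquiv.symm
  haveI : Fintype (A →* Kˣ) := Fintype.ofFinite _
  -- a section of `φ`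
  set s : A → ↥F.fixingSubgroup := Function.surjInv hφ with hs_def
  have hs : ∀ a, φ (s a) = a := Function.surjInv_eq hφ
  -- `x` is fixed by the kernel
  have hfix : ∀ u : ↥F.fixingSubgroup, φ u = 1 → (u : K ≃ₐ[k] K) x = x := by
    intro u hu
    rw [IntermediateField.mem_fixedField_iff] at hx
    exact hx u ⟨u, (MonoidHom.mem_ker).mpr hu, rfl⟩
  -- values of characters are `N`-th roots of unity, hence lie in `F` and are fixed by `Gal(K/F)`
  have hval : ∀ (χ : A →* Kˣ) (a : A), ((χ a : Kˣ) : K) ∈ F := fun χ a =>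
    hμ _ (by rw [← Units.val_pow_eq_pow_val, ← map_pow, hA, map_one, Units.val_one])
  have hvalfix : ∀ (τ : ↥F.fixingSubgroup) (χ : A →* Kˣ) (a : A),
      (τ : K ≃ₐ[k] K) ((χ a : Kˣ) : K) = ((χ a : Kˣ) : K) := fun τ χ a =>
    (IntermediateField.mem_fixingSubgroup_iff _ _).mp τ.2 _ (hval χ a)
  -- the eigen-components
  set e : (A →* Kˣ) → K := fun χ => ∑ a : A, ((χ a⁻¹ : Kˣ) : K) * ((s a : K ≃ₐ[k] K) x) with he_def
  -- (1) `τ s(a) x = s(φ τ · a) x`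
  have hτs : ∀ (τ : ↥F.fixingSubgroup) (a : A),
      (τ : K ≃ₐ[k] K) (((s a : ↥F.fixingSubgroup) : K ≃ₐ[k] K) x) =
        ((s (φ τ * a) : ↥F.fixingSubgroup) : K ≃ₐ[k] K) x := by
    intro τ a
    have hu : φ ((s (φ τ * a))⁻¹ * (τ * s a)) = 1 := by
      rw [map_mul, map_mul, map_inv, hs, hs, mul_inv_rev, mul_assoc, inv_mul_cancel_left, inv_mul_cancel]
    have key := hfix _ hu
    -- `(s(φτ a))⁻¹ (τ (s a x)) = x`, i.e. `τ (s a x) = s(φτ a) x`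
    have key' : ((s (φ τ * a) : ↥F.fixingSubgroup) : K ≃ₐ[k] K).symm
        ((τ : K ≃ₐ[k] K) (((s a : ↥F.fixingSubgroup) : K ≃ₐ[k] K) x)) = x := by
      simpa [Subgroup.coe_mul, Subgroup.coe_inv, AlgEquiv.mul_apply, AlgEquiv.aut_inv] using key
    have key'' := congrArg (((s (φ τ * a) : ↥F.fixingSubgroup) : K ≃ₐ[k] K)) key'
    rwa [AlgEquiv.apply_symm_apply] at key''
  -- (2) `τ e(χ) = χ(φ τ) · e(χ)`
  have heig : ∀ (τ : ↥F.fixingSubgroup) (χ : A →* Kˣ),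
      (τ : K ≃ₐ[k] K) (e χ) = ((χ (φ τ) : Kˣ) : K) * e χ := by
    intro τ χ
    rw [he_def]
    simp only [map_sum, map_mul, hvalfix, hτs]
    rw [Finset.mul_sum]
    -- reindex `a ↦ φ τ * a`
    refine Fintype.sum_equiv (Equiv.mulLeft (φ τ)) _ _ fun a => ?_
    simp only [Equiv.coe_mulLeft]
    rw [← mul_assoc, ← Units.val_mul, ← map_mul, mul_inv_rev, mul_comm a⁻¹, mul_inv_cancel_left]
  -- (3) `e(χ)^N ∈ F`, hence `e χ ∈ F(F^{1/N})`
  have hpow : ∀ χ : A →* Kˣ, e χ ^ N ∈ F := by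
    intro χ
    rw [← InfiniteGalois.fixedField_fixingSubgroup F, IntermediateField.mem_fixedField_iff]
    intro f hf
    rw [map_pow, heig ⟨f, hf⟩ χ, mul_pow, ← Units.val_pow_eq_pow_val, ← map_pow, hA, map_one, Units.val_one,
      one_mul]
  have hmem : ∀ χ : A →* Kˣ, e χ ∈ IntermediateField.adjoin k ((F : Set K) ∪ {x : K | x ^ N ∈ F}) := fun χ => mem_adjoin_roots_of_pow_mem F N (hpow χ)
  -- (4) `Σ_χ e(χ) = #(A →* Kˣ) · x`
  have hsum : ∑ χ : A →* Kˣ, e χ = (Fintype.card (A →* Kˣ) : K) * x := by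
    rw [he_def]
    simp only
    rw [Finset.sum_comm]
    have : ∀ a : A, ∑ χ : A →* Kˣ, ((χ a⁻¹ : Kˣ) : K) * ((s a : K ≃ₐ[k] K) x) =
        (∑ χ : A →* Kˣ, ((χ a⁻¹ : Kˣ) : K)) * ((s a : K ≃ₐ[k] K) x) := fun a => by rw [Finset.sum_mul]
    simp only [this]
    rw [Fintype.sum_eq_single (1 : A)]
    · rw [inv_one, sum_character_apply_one, hfix (s 1) (hs 1)]
    · intro a ha
      rw [sum_character_apply_eq_zero (K := K) (inv_ne_one.mpr ha), zero_mul]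
  -- (5) conclude: `x = (#)⁻¹ · Σ_χ e(χ) ∈ F(F^{1/N})`
  have hcard : (Fintype.card (A →* Kˣ) : K) ≠ 0 := by
    have : 0 < Fintype.card (A →* Kˣ) := Fintype.card_pos_iff.mpr ⟨1⟩
    exact_mod_cast this.ne'
  have hx_eq : x = (Fintype.card (A →* Kˣ) : K)⁻¹ * ∑ χ : A →* Kˣ, e χ := by
    rw [hsum, ← mul_assoc, inv_mul_cancel₀ hcard, one_mul]
  rw [hx_eq]
  exact mul_mem (inv_mem (natCast_mem _ _)) (sum_mem fun χ _ => hmem χ)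

/-- **Kummer containment (surjective form, on Galois groups)**: with the hypotheses of
`fixedField_ker_le_adjoin_roots_of_surjective`, every `σ ∈ Gal(K/F(F^{1/N}))` lies in `Gal(K/F)` and is killed by `φ`.
[cite: Lang2002, Ch. VI §8 Thm. 8.2] -/
theorem apply_eq_one_of_mem_fixingSubgroup_adjoin_roots_of_surjective [CharZero K] [HasEnoughRootsOfUnity K N]
    (hμ : ∀ ζ : K, ζ ^ N = 1 → ζ ∈ F)
    {A : Type*} [CommGroup A] [Finite A] (hA : ∀ a : A, a ^ N = 1)
    (φ : ↥F.fixingSubgroup →* A) (hφ : Function.Surjective φ)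
    (hopen : IsOpen ((φ.ker.map F.fixingSubgroup.subtype : Subgroup (K ≃ₐ[k] K)) : Set (K ≃ₐ[k] K)))
    {σ : K ≃ₐ[k] K} (hσ : σ ∈ (IntermediateField.adjoin k ((F : Set K) ∪ {x : K | x ^ N ∈ F})).fixingSubgroup) :
    ∃ h : σ ∈ F.fixingSubgroup, φ ⟨σ, h⟩ = 1 := by
  -- the kernel is open, hence closed, hence the fixing subgroup of its fixed field
  set U' : Subgroup (K ≃ₐ[k] K) := φ.ker.map F.fixingSubgroup.subtype with hU'
  have hclosed : IsClosed (U' : Set (K ≃ₐ[k] K)) := U'.isClosed_of_isOpen hopen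
  have hfix : (IntermediateField.fixedField U').fixingSubgroup = U' :=
    InfiniteGalois.fixingSubgroup_fixedField ⟨U', hclosed⟩
  -- `σ` fixes `F(F^{1/N}) ⊇ fixedField U'`, so `σ ∈ U'`
  have hσU : σ ∈ U' := by
    rw [← hfix, IntermediateField.mem_fixingSubgroup_iff]
    intro x hx
    exact (IntermediateField.mem_fixingSubgroup_iff _ _).mp hσ x
      (fixedField_ker_le_adjoin_roots_of_surjective F N hμ hA φ hφ hx)
  obtain ⟨u, hu, rfl⟩ := hσU
  exact ⟨u.2, (MonoidHom.mem_ker).mp hu⟩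

/-- **KUMMER CONTAINMENT.**  `K/k` Galois, `F` an intermediate field containing all `N`-th roots of unity of `K`, `K` of
characteristic `0` with enough `N`-th roots of unity.  For EVERY homomorphism `φ : Gal(K/F) → A` into a finite commutative
group killed by `N` whose kernel is open in `Gal(K/k)`, the subgroup `Gal(K/F(F^{1/N}))` lies in the kernel: every
`σ` fixing `F(F^{1/N}) = k(F ∪ {x | x^N ∈ F})` belongs to `Gal(K/F)` and satisfies `φ σ = 1`.  («The abelian extensions of
`F` of exponent `N` inside `K` are contained in `F(F^{1/N})`.») [cite: Lang2002, Ch. VI §8 Thm. 8.2]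
[cite: NeukirchANT1999, Ch. IV (3.6)] -/
theorem apply_eq_one_of_mem_fixingSubgroup_adjoin_roots [CharZero K] [HasEnoughRootsOfUnity K N]
    (hμ : ∀ ζ : K, ζ ^ N = 1 → ζ ∈ F)
    {A : Type*} [CommGroup A] [Finite A] (hA : ∀ a : A, a ^ N = 1)
    (φ : ↥F.fixingSubgroup →* A)
    (hopen : IsOpen ((φ.ker.map F.fixingSubgroup.subtype : Subgroup (K ≃ₐ[k] K)) : Set (K ≃ₐ[k] K)))
    {σ : K ≃ₐ[k] K} (hσ : σ ∈ (IntermediateField.adjoin k ((F : Set K) ∪ {x : K | x ^ N ∈ F})).fixingSubgroup) :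
    ∃ h : σ ∈ F.fixingSubgroup, φ ⟨σ, h⟩ = 1 := by
  -- pass to the surjection onto the range (same kernel)
  have hA' : ∀ a : ↥φ.range, a ^ N = 1 := fun a => Subtype.ext (by
    rw [Subgroup.coe_pow, hA, Subgroup.coe_one])
  have hker : φ.rangeRestrict.ker = φ.ker := MonoidHom.ker_rangeRestrict φ
  have hopen' : IsOpen ((φ.rangeRestrict.ker.map F.fixingSubgroup.subtype : Subgroup (K ≃ₐ[k] K)) :
      Set (K ≃ₐ[k] K)) := by rwa [hker]
  obtain ⟨h, h1⟩ := apply_eq_one_of_mem_fixingSubgroup_adjoin_roots_of_surjective F N hμ hA' φ.rangeRestrict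
    φ.rangeRestrict_surjective hopen' hσ
  exact ⟨h, by simpa [MonoidHom.rangeRestrict, Subtype.ext_iff] using h1⟩

/-- Subgroup form: `Gal(K/F(F^{1/N})) ≤ (Ker φ) ↪ Gal(K/k)`. [cite: Lang2002, Ch. VI §8 Thm. 8.2] -/
theorem fixingSubgroup_adjoin_roots_le_ker [CharZero K] [HasEnoughRootsOfUnity K N]
    (hμ : ∀ ζ : K, ζ ^ N = 1 → ζ ∈ F)
    {A : Type*} [CommGroup A] [Finite A] (hA : ∀ a : A, a ^ N = 1)
    (φ : ↥F.fixingSubgroup →* A)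
    (hopen : IsOpen ((φ.ker.map F.fixingSubgroup.subtype : Subgroup (K ≃ₐ[k] K)) : Set (K ≃ₐ[k] K))) :
    (IntermediateField.adjoin k ((F : Set K) ∪ {x : K | x ^ N ∈ F})).fixingSubgroup ≤ φ.ker.map F.fixingSubgroup.subtype := by
  intro σ hσ
  obtain ⟨h, h1⟩ := apply_eq_one_of_mem_fixingSubgroup_adjoin_roots F N hμ hA φ hopen hσ
  exact ⟨⟨σ, h⟩, (MonoidHom.mem_ker).mpr h1, rfl⟩

omit [IsGalois k K] [NeZero N] in
/-- In particular `Gal(K/F(F^{1/N})) ≤ Gal(K/F)` — clear from `F ≤ F(F^{1/N})`. [cite: Lang2002, Ch. VI §8] -/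
theorem fixingSubgroup_adjoin_roots_le : (IntermediateField.adjoin k ((F : Set K) ∪ {x : K | x ^ N ∈ F})).fixingSubgroup ≤ F.fixingSubgroup := by
  intro σ hσ
  rw [IntermediateField.mem_fixingSubgroup_iff] at hσ ⊢
  exact fun x hx => hσ x (le_adjoin_roots F N hx)

end Main

end KummerContainment

end Literature.FieldTheory

end
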